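import Mathlib
import Summits.Ventures.HodgeRepro.Tier4.Common.TorusPathAdeles
import Summits.Ventures.HodgeRepro.Tier4.Common.LocalTorusCompact

/-!
# Tier4/Common/TorusPath — the continuous path `θ ↦ e^{iθ}` in the local torus `T_{w₀}` of a row plane, and
`1` is NOT ISOLATED in `G(𝔸)`: `(𝓝[≠] (1 : GA (ofLinesRow q a b ε))).NeBot`, also for the seesaw plane

Blind re-derivation cell `pub-hodge-repro`, Tier 4 «prove the step» (README §9–§10), seat t4-typer-2 (gen 4), on
t4-L3-p1 g3's TAKE (S15110) of the offer S15098 — module 2 of 2 (the `400`-line rule); the curve and the adeles are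
`Common/TorusPathAdeles.lean`.  Target tree path `lean/Summits/Ventures/HodgeRepro/Tier4/Common/TorusPath.lean`.
Imports: Mathlib + `Common.TorusPathAdeles` (`xiR`, `etaR`, `adOne`, `adZero`, `normForm_adOne_adZero`,
`xi_add_eta_mul_wroot`, the component lemmas) + `Common.LocalTorusCompact` (`finiteComponent_eq_one_iff`,
`infiniteComponent_eq_one_iff`); through them RowTorus (`torusUnit`, `mem_torusT_ofLinesRow_of_blocks`), RowWeights,
LocalUnitary (`blockOf_one_zero`).

**`torusPath θ := torusUnit (adOne (ξ θ)) (adZero (η θ)) 1 0`** is an element of the torus of the row plane, supported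
at `w₀` (`torusPath_mem_localTorusAt`), continuous (`continuous_torusPath`), `torusPath 0 = 1`, with first-line weight
`cos θ + i sin θ` (`weightAt_torusPath`); so `torusPath θ ≠ 1` for `θ ∈ (0, π)` and `1 ∈ closure {1}ᶜ`:
**`nhdsWithin_compl_singleton_neBot_ofLinesRow`**, and **`nhdsWithin_compl_singleton_neBot_seesaw`** for the seesaw plane
`(mixedRow q a₀ a₂).withTransportedTorus g g'` (same group: `B`, `Ω` unchanged) — the input `hnd` of L3-p1's
`lpInfinite_of_nonDiscrete` (display (10) of Skeleton v0.33).

Nothing here says anything about the status of the Hodge conjecture for CM abelian varieties, which is NOT proved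
(HC_CM is NOT proved by anyone in this repository).
-/

set_option autoImplicit false

noncomputable section

namespace Summit.Ventures.HodgeRepro.Tier4.Common

open NumberField IsDedekindDomain Matrix Set Topology Filter
open scoped Classical

section Path

variable {k : Type} [Field k] [NumberField k] (q : QuadData k) (a b ε : k) {w₀ : InfinitePlace k}
  (hw : w₀.IsReal) (hcm : IsCMAt q w₀)

/-- The trivial norm-one identity for the block `(1, 0)`. -/
theorem normForm_one_zero :
    (1 : Ad k) ^ 2 + algebraMap k (Ad k) q.t * 1 * 0 + algebraMap k (Ad k) q.n * (0 : Ad k) ^ 2 = 1 := by ring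

/-- **The path `θ ↦ e^{iθ}` in the torus of the row plane**, as an element of `G(𝔸)`: the block
`(adOne (ξ θ)) + (adZero (η θ)) ω` on the first line, `1` on the second. -/
def torusPath (θ : ℝ) : GA (PlaneData.ofLinesRow q a b ε) :=
  ⟨torusUnit q (adOne hw (xiR q w₀ θ)) (adZero hw (etaR q w₀ θ)) 1 0
      (normForm_adOne_adZero q hw (normForm_xi_eta hcm θ)) (normForm_one_zero q),
    (mem_torusT_ofLinesRow_of_blocks q a b ε _ _ 1 0 (normForm_adOne_adZero q hw (normForm_xi_eta hcm θ))
      (normForm_one_zero q)).choose⟩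

/-- The path lies in the torus. -/
theorem torusPath_mem_torusT (θ : ℝ) : torusPath q a b ε hw hcm θ ∈ torusT (PlaneData.ofLinesRow q a b ε) :=
  (mem_torusT_ofLinesRow_of_blocks q a b ε _ _ 1 0 (normForm_adOne_adZero q hw (normForm_xi_eta hcm θ))
    (normForm_one_zero q)).choose_spec

/-- The matrix of the path. -/
theorem mat_torusPath (θ : ℝ) :
    GA.mat (PlaneData.ofLinesRow q a b ε) (torusPath q a b ε hw hcm θ) =
      blockDiag4R (blockOf (algebraMap k (Ad k) q.t) (algebraMap k (Ad k) q.n) (adOne hw (xiR q w₀ θ))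
        (adZero hw (etaR q w₀ θ)))
        (blockOf (algebraMap k (Ad k) q.t) (algebraMap k (Ad k) q.n) 1 0) := rfl

/-- The matrix of the inverse of the path. -/
theorem mat_torusPath_inv (θ : ℝ) :
    GA.mat (PlaneData.ofLinesRow q a b ε) (torusPath q a b ε hw hcm θ)⁻¹ =
      blockDiag4R (blockOf (algebraMap k (Ad k) q.t) (algebraMap k (Ad k) q.n)
        (adOne hw (xiR q w₀ θ) + algebraMap k (Ad k) q.t * adZero hw (etaR q w₀ θ)) (-adZero hw (etaR q w₀ θ)))
        (blockOf (algebraMap k (Ad k) q.t) (algebraMap k (Ad k) q.n) (1 + algebraMap k (Ad k) q.t * 0) (-0)) := rfl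

/-- `θ ↦ blockDiag4R (A θ) (D θ)` is continuous when `A`, `D` are. -/
theorem continuous_blockDiag4R {X : Type} [TopologicalSpace X] {A D : X → Matrix (Fin 2) (Fin 2) (Ad k)}
    (hA : Continuous A) (hD : Continuous D) : Continuous fun x => blockDiag4R (A x) (D x) := by
  have h : Continuous fun x => fromBlocks (A x) (0 : Matrix (Fin 2) (Fin 2) (Ad k)) 0 (D x) :=
    hA.matrix_fromBlocks continuous_const continuous_const hD
  simp only [blockDiag4R, re4R, coe_reindexAlgEquiv, reindex_apply]
  exact h.matrix_submatrix _ _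

/-- `θ ↦ blockOf t n (x θ) (y θ)` is continuous when `x`, `y` are. -/
theorem continuous_blockOf {X : Type} [TopologicalSpace X] {x y : X → Ad k} (hx : Continuous x)
    (hy : Continuous y) :
    Continuous fun s => blockOf (algebraMap k (Ad k) q.t) (algebraMap k (Ad k) q.n) (x s) (y s) := by
  unfold blockOf
  exact (hx.smul continuous_const).add (hy.smul continuous_const)

/-- **The path is continuous.** -/
theorem continuous_torusPath : Continuous (torusPath q a b ε hw hcm) := by
  have hx : Continuous fun θ => adOne (k := k) hw (xiR q w₀ θ) := (continuous_adOne hw).comp continuous_xiR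
  have hy : Continuous fun θ => adZero (k := k) hw (etaR q w₀ θ) := (continuous_adZero hw).comp continuous_etaR
  refine Continuous.subtype_mk ?_ _
  refine Units.continuous_iff.2 ⟨?_, ?_⟩
  · show Continuous fun θ => GA.mat (PlaneData.ofLinesRow q a b ε) (torusPath q a b ε hw hcm θ)
    simp only [mat_torusPath]
    exact continuous_blockDiag4R (continuous_blockOf q hx hy) continuous_const
  · show Continuous fun θ => GA.mat (PlaneData.ofLinesRow q a b ε) (torusPath q a b ε hw hcm θ)⁻¹
    simp only [mat_torusPath_inv]
    exact continuous_blockDiag4R (continuous_blockOf q (hx.add (continuous_const.mul hy)) hy.neg) continuous_const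

/-- **`torusPath 0 = 1`.** -/
theorem torusPath_zero : torusPath q a b ε hw hcm 0 = 1 := by
  apply Subtype.ext
  apply Units.ext
  change GA.mat (PlaneData.ofLinesRow q a b ε) (torusPath q a b ε hw hcm 0) = 1
  rw [mat_torusPath, xiR_zero, etaR_zero, adOne_one, adZero_zero, blockOf_one_zero, blockDiag4R_one]

/-- **The weight of the path on the first line is `cos θ + i sin θ`.** -/
theorem weightAt_torusPath (θ : ℝ) :
    weightAt (PlaneData.ofLinesRow q a b ε) q w₀ 0 (torusPath q a b ε hw hcm θ) =
      (Real.cos θ : ℂ) + (Real.sin θ : ℂ) * Complex.I := by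
  rw [weightAt_zero_of_mat q w₀ _ _ _ _ _ _ (mat_torusPath q a b ε hw hcm θ), adToC_adOne, adToC_adZero]
  exact xi_add_eta_mul_wroot hw hcm θ

/-- `blockDiag4R` commutes with entrywise ring homomorphisms. -/
theorem blockDiag4R_map {R S : Type} [CommRing R] [CommRing S] (f : R →+* S) (A D : Matrix (Fin 2) (Fin 2) R) :
    (blockDiag4R A D).map f = blockDiag4R (A.map f) (D.map f) := by
  simp only [blockDiag4R, re4R, coe_reindexAlgEquiv, reindex_apply]
  rw [← Matrix.submatrix_map, fromBlocks_map, Matrix.map_zero _ (map_zero _)]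

/-- `blockOf` commutes with entrywise ring homomorphisms. -/
theorem blockOf_map {R S : Type} [CommRing R] [CommRing S] (f : R →+* S) (t n x y : R) :
    (blockOf t n x y).map f = blockOf (f t) (f n) (f x) (f y) := by
  ext i j
  fin_cases i <;> fin_cases j <;> simp [blockOf, omegaMatR]

/-- A ring-homomorphic image of the path's matrix is `1` when the image of `adOne` is `1` and of `adZero` is `0`. -/
theorem mat_torusPath_map_eq_one {S : Type} [CommRing S] (f : Ad k →+* S) (θ : ℝ)
    (h1 : f (adOne hw (xiR q w₀ θ)) = 1) (h0 : f (adZero hw (etaR q w₀ θ)) = 0) :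
    (GA.mat (PlaneData.ofLinesRow q a b ε) (torusPath q a b ε hw hcm θ)).map f = 1 := by
  rw [mat_torusPath, blockDiag4R_map, blockOf_map, blockOf_map, h1, h0, map_one, map_zero, blockOf_one_zero,
    blockDiag4R_one]

/-- The path is supported at `w₀` (components `1` at the finite places and at `w ≠ w₀`). -/
theorem torusPath_mem_localTorusAt (θ : ℝ) :
    torusPath q a b ε hw hcm θ ∈ localTorusAt (PlaneData.ofLinesRow q a b ε) w₀ := by
  refine ⟨torusPath_mem_torusT q a b ε hw hcm θ, ?_, ?_⟩
  · intro v
    rw [finiteComponent_eq_one_iff]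
    intro i j
    have h := mat_torusPath_map_eq_one q a b ε hw hcm (adComponentFin k v) θ (adComponentFin_adOne hw v _)
      (adComponentFin_adZero hw v _)
    have := congrFun (congrFun h i) j
    rwa [Matrix.map_apply] at this
  · intro w hww
    rw [infiniteComponent_eq_one_iff]
    intro i j
    have h := mat_torusPath_map_eq_one q a b ε hw hcm (adComponentInf k w) θ
      (adComponentInf_adOne_of_ne hw hww _) (adComponentInf_adZero_of_ne hw hww _)
    have := congrFun (congrFun h i) j
    rwa [Matrix.map_apply] at this

/-- **`torusPath θ ≠ 1` for `0 < θ < π`** (its first-line weight has imaginary part `sin θ > 0`). -/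
theorem torusPath_ne_one {θ : ℝ} (h0 : 0 < θ) (hπ : θ < Real.pi) : torusPath q a b ε hw hcm θ ≠ 1 := by
  intro h
  have h1 := weightAt_torusPath q a b ε hw hcm θ
  rw [h, weightAt_one] at h1
  have him := congrArg Complex.im h1
  simp only [Complex.one_im, Complex.add_im, Complex.ofReal_im, Complex.mul_im, Complex.I_re, Complex.I_im,
    Complex.ofReal_re, mul_zero, mul_one, zero_add, add_zero] at him
  exact (Real.sin_pos_of_pos_of_lt_pi h0 hπ).ne' him.symm

include hw hcm in
/-- **`1` is not isolated in `G(𝔸)` of a row plane** (a real CM place `w₀`): the path `torusPath θ → 1` as `θ → 0⁺`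
with `torusPath θ ≠ 1`. -/
theorem nhdsWithin_compl_singleton_neBot_ofLinesRow :
    (nhdsWithin (1 : GA (PlaneData.ofLinesRow q a b ε)) {1}ᶜ).NeBot := by
  rw [← mem_closure_iff_nhdsWithin_neBot]
  have ht : Tendsto (torusPath q a b ε hw hcm) (nhdsWithin 0 (Set.Ioo 0 Real.pi)) (𝓝 1) := by
    rw [← torusPath_zero q a b ε hw hcm]
    exact ((continuous_torusPath q a b ε hw hcm).tendsto 0).mono_left nhdsWithin_le_nhds
  haveI : (nhdsWithin (0 : ℝ) (Set.Ioo 0 Real.pi)).NeBot := by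
    rw [← mem_closure_iff_nhdsWithin_neBot, closure_Ioo Real.pi_pos.ne]
    exact ⟨le_rfl, Real.pi_pos.le⟩
  refine mem_closure_of_tendsto ht ?_
  filter_upwards [self_mem_nhdsWithin] with θ hθ
  exact torusPath_ne_one q a b ε hw hcm hθ.1 hθ.2

end Path

section Seesaw

variable {k : Type} [Field k] [NumberField k] (q : QuadData k) (a : Fin 4 → k)
  (g g' : Matrix (Fin 4) (Fin 4) k) (hgg' : g * g' = 1) (hg'g : g' * g = 1)
  (hgΩ : g * (PlaneData.mixedRow q (a 0) (a 2)).Ω = (PlaneData.mixedRow q (a 0) (a 2)).Ω * g)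
  {w₀ : InfinitePlace k} (hw : w₀.IsReal) (hcm : IsCMAt q w₀)

include hw hcm in
/-- **`1` is not isolated in `G(𝔸)` of the SEESAW plane** `(mixedRow q a₀ a₂).withTransportedTorus g g'` (its group is
the row plane's: `B`, `Ω` unchanged by the transport). -/
theorem nhdsWithin_compl_singleton_neBot_seesaw :
    (nhdsWithin (1 : GA ((PlaneData.mixedRow q (a 0) (a 2)).withTransportedTorus g g' hgg' hg'g hgΩ)) {1}ᶜ).NeBot :=
  nhdsWithin_compl_singleton_neBot_ofLinesRow q (a 0) (a 2) (-1) hw hcm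

omit hw hcm in
/-- **The seesaw NeBot with the skeleton's binders**: all places real (`k = E⁺`) and `IsCMAt q w` at every place (display
(9)); the path lives at an arbitrary place `w₀` (`Nonempty (InfinitePlace k)`). -/
theorem nhdsWithin_compl_singleton_neBot_seesaw_of_forall (hreal : ∀ w : InfinitePlace k, w.IsReal)
    (hcmAll : ∀ w : InfinitePlace k, IsCMAt q w) :
    (nhdsWithin (1 : GA ((PlaneData.mixedRow q (a 0) (a 2)).withTransportedTorus g g' hgg' hg'g hgΩ)) {1}ᶜ).NeBot :=
  nhdsWithin_compl_singleton_neBot_seesaw q a g g' hgg' hg'g hgΩ (hreal (Classical.arbitrary (InfinitePlace k)))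
    (hcmAll (Classical.arbitrary (InfinitePlace k)))

end Seesaw


end Summit.Ventures.HodgeRepro.Tier4.Common

end
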